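import Summits.AtomisticToContinuum.Crystallization.Theses.PricedLinkCensus
import Summits.AtomisticToContinuum.Crystallization.Theorems.PricedLinkCensusTruncatedCensusGapNoOvercoordinationOfGappedKissing

/-!
# Birth certificate (BC3) — crux `PricedLinkCensus.TruncatedCensusGap` (stmt-AtomisticToContinuum-14230)

Skeleton registrar `planner-skel-stmt-AtomisticToContinuum-14230-0` (2026-08-17), route
`route-AtomisticToContinuum-PricedLinkCensus` (re-audit bin REPAIRABLE, `bc3_audit: null`).
Published as `Cruxes/TruncatedCensusGap/Lines/birth.lean`; it coexists with the three working lines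
(`Lines/sharp_m_potential_compactness.lean`, `…/frustration_free_census_germ.lean`,
`…/metrical_charge_coercivity.lean`) and does not replace them: a lead that drives one of those lines
re-registers its own skeleton at its cycle start as usual.

THE CRUX. `TruncatedCensusGap : ∃ κ > 0, ∀ N (y : Fin N → ℝ³) injective,
N · e_χ* + κ · #{i | ¬ IsChargeFree (1/100) y i} ≤ E_χ(y)` for the range-2 truncated Lennard-Jones
potential `V_χ r = min 1 (max 0 (4 − 2r)) · V_LJ r`, `e_χ* = ⨅_Q e_χ(Q)` over periodic `Q`.

THE SEAM (the route's own census, "every charge is a missing bond or a ring defect"). A site `i` is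
charge-free at tolerance `η₀ = 1/100` iff `b_i = 12` and every bond at `i` has ring number `4`
(`Literature.Geometry.DiscreteGeometry.IsChargeFree`). Hence the CHARGED set is partitioned by the link
census into three classes of different physics:

* (O) OVER-coordinated sites, `b_i > 12` — EMPTY for injective configurations: the bonded neighbours of
  `i` lie in the shell `nn_i ≤ |y_j − y_i| ≤ 1.01·nn_i` and are pairwise `≥ nn_i/1.01` apart, i.e. at
  angular separation `≥ 2·arcsin(0.990099/2.02) ≈ 58.70°`, while thirteen points on `S²` have minimal
  separation `≤ 57.137°` (Tammes `N = 13`, Musin–Tarasov 2012, "The strong thirteen spheres problem",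
  Discrete Comput. Geom. 48; margin `1.56°`; the route header: "Tammes-13 needs 2.2 %").
  → `stub_noOvercoordination` (pure spherical geometry / certified enumeration; FALSE without
  injectivity: fourteen coincident points are pairwise bonded).
* (U) UNDER-coordinated sites, `b_i < 12` — missing-bond charge: free surfaces, vacancies, AND the
  generic elastic threshold event of `Disproof.lean` §6 (`not_isChargeFree_of_short_bond`: one bond
  compressed by > 1 % strips both end points to `b = 1` and their 18 former partners to `b = 11`).
  → `stub_underCoordinationGap`: `∃ κ_U > 0, N e_χ* + κ_U · #U ≤ E_χ(y)` (the Heitmann–Radin /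
  De Luca–Friesecke "missing bond costs pair energy" column of the price list, `κ_b`).
* (R) RING-defective sites at FULL coordination, `b_i = 12 ∧ ∃ bond with ring number ≠ 4` —
  tetrahedral-frustration charge: icosahedral `Z12` shells (ring number 5), the decahedral `D₅ₕ` shell
  of negatives item 4146, Frank–Kasper order; no bond is missing, the price is second-shell
  (`κ_q`, `κ_5` of the card; FlatleyEtAl2013: ≤ 24 link edges among 12 kissing points).
  → `stub_ringCensusGap`: `∃ κ_R > 0, N e_χ* + κ_R · #R ≤ E_χ(y)`.

COMPOSITION (`TruncatedCensusGap_of`, sorry-free, ~40 lines, concludes the route decl BY NAME): by (O)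
every charged site is in `U ∪ R`, so `#charged ≤ #U + #R`; the convex combination
`½·(U-gap) + ½·(R-gap)` gives `N e_χ* + (min κ_U κ_R / 2)·#charged ≤ E_χ(y)`.

CALIBRATION (sorry-free, §4): `U ⊆ charged` and `R ⊆ charged`, so the crux implies each pricing stub
(`underCoordinationGap_of_truncatedCensusGap`, `ringCensusGap_of_truncatedCensusGap`): the split loses
no strength, and NEITHER pricing stub alone is the crux (a `U`-pricing says nothing about a bulk
icosahedral/Frank–Kasper phase, all of whose sites are twelve-coordinated; an `R`-pricing says nothing
about a cluster gas / vacancy lattice, all of whose charged sites are under-coordinated).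

DISPROOF USED (`Cruxes/TruncatedCensusGap/Disproof.lean`, cdisprove g2; landed
`Theorems/TruncatedCensusGap/Negative/KappaZeroHalf.lean`, `…/WithoutInjective.lean`):
`truncatedCensusGap_false_without_injective` honoured — all three stubs carry `Function.Injective y`,
and (O) genuinely consumes it; `truncatedCensusGap_kappa_zero_iff_bddBelow` — each pricing stub contains
the `κ = 0` half (periodisation) and therefore implies `BddBelow`, exactly as the crux does; §6 numerics
(any valid `κ ≤ 2.7e-5`, elastic) live entirely in class (U). No stub is an instance refuted by a
landed Negative lemma; `-- Targets`: none.

BC3 PROBES (registrar session, files `bc/stub_*_probe.lean`): for each of the three stubs `S`,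
`example : S → TruncatedCensusGap` and `example : S → Crystallization` by
`first | exact? | simpa | aesop` FAIL (see NOTES.md `birth-certificate:` for rc and messages).

LEAD c4 RESHAPE r1 (prover-line-stmt-AtomisticToContinuum-14230-c4-0, 2026-08-17): stub (O) is split at the
skeleton level into the pure spherical-code statement and the bond-graph reduction —
* `stub_gappedKissingOnePercent` (O1): every finite set of unit vectors of `ℝ³` with pairwise distances
  `≥ 100/101` has at most twelve elements (the 1 %-GAPPED KISSING bound, angular separation
  `≥ arccos(5201/10201) = 59.35°`; implied by the named fact `musinTarasov2012_tammes_thirteen`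
  (threshold `0.957`), by Böröczky–Szabó 2003 (`d₁₃ < 58.7°`), and — the lead's own stub — to be proved
  outright by Musin's LP-with-cap method re-optimised at `59.35°`, template
  `Literature/Geometry/DiscreteGeometry/KissingNumberThree*` (`60°`, proved in tree));
* `stub_noOvercoordination_of_gappedKissing` (O2): (O1) ⇒ (O) — at a site `i` of an injective configuration
  the bond directions `(y j − y i)/‖y j − y i‖`, `j ∈ N(i)`, are pairwise at chord distance `≥ 100/101`
  (`nn_i ≤ ‖y j − y i‖ ≤ 1.01·nn_i` and `‖y j − y k‖ ≥ max(nn_j, nn_k) ≥ max(‖y j − y i‖, ‖y k − y i‖)/1.01`),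
  and distinct neighbours give distinct directions.
(U) and (R) are unchanged. Composition: `TruncatedCensusGap_of h₀ h₂ h₃` with (O) := (O2, landed p141737) h₀.

LEAD c4 STATE at the end of cycle 1 (2026-08-17): O2 LANDED p141737; (O1) and (O) modulo the named fact
`musinTarasov2012_tammes_thirteen` LANDED p144894 (`gappedKissingOnePercent_of_tammes13`,
`noOvercoordination_of_tammes13`); the UNCONDITIONAL (O1) is NOT reachable by Musin's LP-with-cap method
(re-optimised at 59.35°: best bound 13.033 > 13, evidence MUSIN-LP.md) — it needs a three-point (SDP)
certificate in dimension 3, which EXISTS (Bachoc–Vallentin 2008 §5: d = 10 at cos 0.5225 gives 12.99 ⇒ d₁₃ < 58.5°;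
this seat's grid-relaxed BV program for S²: 12.69 at d = 6 and 59.35°, evidence BV3PT.md): item-sized, low leverage. (U) ⇔ periodic U-pricing (p142364, p143843, with U-locality p141858);
(R) ⇔ periodic R-pricing (p142708, p143150, p145179, with R-locality p142315): both are finite-range
PERIODIC crystallization statements for `V_χ` with linear pricing of the respective motif count above
`e_χ*` — crux-sized (CH-PRICE of line smpc, split by census class). NOTE on class (R): it is not only
tetrahedral frustration — stretching ONE in-plane nn bond of hcp* past 1 % (δ > 0.00332·a per atom)
leaves the bond's four common neighbours twelve-coordinated with two rings `= 3`: `#R = 4`, `#U = 2` for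
`ΔE = 4.9e-4`, so any valid `κ_R ≤ 1.2e-4` is an ELASTIC constant, like `κ_U ≤ 2.7e-5` (Disproof §6).
-/

noncomputable section

namespace Summit.AtomisticToContinuum.Crystallization.Cruxes.TruncatedCensusGap.Birth

open scoped BigOperators Classical
open Literature.MathematicalPhysics.StatisticalMechanics Literature.Geometry.DiscreteGeometry
open Summit.AtomisticToContinuum.Crystallization.Theses.PricedLinkCensus (TruncatedCensusGap)

/-! ## §1 The three statements (named Props; the registered stubs of §2 restate them verbatim) -/

/-- **(O) No over-coordination at tolerance `1/100`**: in the scale-free bond graph of an injective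
finite configuration in `ℝ³`, every site has at most twelve bonds (Tammes `N = 13` with `1 %` slack). -/
def NoOvercoordination : Prop :=
  ∀ (N : ℕ) (y : Fin N → EuclideanSpace ℝ (Fin 3)), Function.Injective y → ∀ i : Fin N,
    ((Literature.Geometry.DiscreteGeometry.bondGraph (1 / 100 : ℝ) y).neighborSet i).ncard ≤ 12

/-- **(O1) The 1 %-gapped kissing bound**: unit vectors of `ℝ³` pairwise at distance `≥ 100/101`
number at most twelve. -/
def GappedKissingOnePercent : Prop :=
  ∀ T : Finset (EuclideanSpace ℝ (Fin 3)), (∀ v ∈ T, ‖v‖ = 1) →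
    (∀ v ∈ T, ∀ w ∈ T, v ≠ w → (100 / 101 : ℝ) ≤ dist v w) → T.card ≤ 12

/-- **(U) Under-coordination census gap**: the truncated energy pays `κ_U > 0` per site with fewer
than twelve bonds, above `N e_χ*`, for every finite injective configuration (no boundary term). -/
def UnderCoordinationGap : Prop :=
  ∃ κ : ℝ, 0 < κ ∧ ∀ (N : ℕ) (y : Fin N → EuclideanSpace ℝ (Fin 3)), Function.Injective y →
    (N : ℝ) * (⨅ Q : Literature.MathematicalPhysics.StatisticalMechanics.PeriodicConfiguration 3,
        Q.energyPerParticle (fun r => min 1 (max 0 (4 - 2 * r)) *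
          Literature.MathematicalPhysics.StatisticalMechanics.lennardJones r)) +
      κ * (Nat.card {i : Fin N //
        ((Literature.Geometry.DiscreteGeometry.bondGraph (1 / 100 : ℝ) y).neighborSet i).ncard < 12} : ℝ) ≤
    Literature.MathematicalPhysics.StatisticalMechanics.interactionEnergy
      (fun r => min 1 (max 0 (4 - 2 * r)) *
        Literature.MathematicalPhysics.StatisticalMechanics.lennardJones r) y

/-- **(R) Ring census gap at full coordination**: the truncated energy pays `κ_R > 0` per
twelve-coordinated site having a bond whose ring number is not `4`, above `N e_χ*`. -/
def RingCensusGap : Prop :=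
  ∃ κ : ℝ, 0 < κ ∧ ∀ (N : ℕ) (y : Fin N → EuclideanSpace ℝ (Fin 3)), Function.Injective y →
    (N : ℝ) * (⨅ Q : Literature.MathematicalPhysics.StatisticalMechanics.PeriodicConfiguration 3,
        Q.energyPerParticle (fun r => min 1 (max 0 (4 - 2 * r)) *
          Literature.MathematicalPhysics.StatisticalMechanics.lennardJones r)) +
      κ * (Nat.card {i : Fin N //
        ((Literature.Geometry.DiscreteGeometry.bondGraph (1 / 100 : ℝ) y).neighborSet i).ncard = 12 ∧
          ∃ j ∈ (Literature.Geometry.DiscreteGeometry.bondGraph (1 / 100 : ℝ) y).neighborSet i,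
            Literature.Geometry.DiscreteGeometry.ringNumber (1 / 100 : ℝ) y i j ≠ 4} : ℝ) ≤
    Literature.MathematicalPhysics.StatisticalMechanics.interactionEnergy
      (fun r => min 1 (max 0 (4 - 2 * r)) *
        Literature.MathematicalPhysics.StatisticalMechanics.lennardJones r) y

/-! ## §2 The registered stubs (`sorry` lives only in these three theorems)

Each `stub_*` restates its statement of §1 VERBATIM over tree declarations (fully qualified), so that
the signature recorded by `ledger skeleton check` elaborates in the route context. -/

/-- **STUB (O1)** — the 1 %-gapped kissing bound on `S²` (lead c4's own stub: Musin's method at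
`θ* = arccos(5201/10201)`; conditional on `musinTarasov2012_tammes_thirteen` it is one application). -/
theorem stub_gappedKissingOnePercent :
    ∀ T : Finset (EuclideanSpace ℝ (Fin 3)), (∀ v ∈ T, ‖v‖ = 1) →
      (∀ v ∈ T, ∀ w ∈ T, v ≠ w → (100 / 101 : ℝ) ≤ dist v w) → T.card ≤ 12 := by
  sorry

example : GappedKissingOnePercent := stub_gappedKissingOnePercent

/-- **STUB (O2), LANDED p141737** — the bond-graph reduction: the gapped kissing bound gives no over-coordination at
tolerance `1/100` for injective configurations (bond directions at a site form a `100/101`-code). -/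
theorem stub_noOvercoordination_of_gappedKissing :
    (∀ T : Finset (EuclideanSpace ℝ (Fin 3)), (∀ v ∈ T, ‖v‖ = 1) →
      (∀ v ∈ T, ∀ w ∈ T, v ≠ w → (100 / 101 : ℝ) ≤ dist v w) → T.card ≤ 12) →
    ∀ (N : ℕ) (y : Fin N → EuclideanSpace ℝ (Fin 3)), Function.Injective y → ∀ i : Fin N,
      ((Literature.Geometry.DiscreteGeometry.bondGraph (1 / 100 : ℝ) y).neighborSet i).ncard ≤ 12 :=
  -- LANDED p141737 (stub-worker, wave 1)
  Summit.AtomisticToContinuum.Crystallization.Theorems.PricedLinkCensusTruncatedCensusGap.stub_noOvercoordination_of_gappedKissing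

example : GappedKissingOnePercent → NoOvercoordination := stub_noOvercoordination_of_gappedKissing

/-- (O) from (O1) and (O2). -/
theorem noOvercoordination_of (h₀ : GappedKissingOnePercent)
    (h₁ : GappedKissingOnePercent → NoOvercoordination) : NoOvercoordination := h₁ h₀

/-- **STUB (U)** — the under-coordination census gap (missing-bond pricing; XL: contains the `κ = 0`
half `N e_χ* ≤ E_χ` and the elastic-threshold pricing of `Disproof.lean` §6). -/
theorem stub_underCoordinationGap :
    ∃ κ : ℝ, 0 < κ ∧ ∀ (N : ℕ) (y : Fin N → EuclideanSpace ℝ (Fin 3)), Function.Injective y →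
      (N : ℝ) * (⨅ Q : Literature.MathematicalPhysics.StatisticalMechanics.PeriodicConfiguration 3,
          Q.energyPerParticle (fun r => min 1 (max 0 (4 - 2 * r)) *
            Literature.MathematicalPhysics.StatisticalMechanics.lennardJones r)) +
        κ * (Nat.card {i : Fin N //
          ((Literature.Geometry.DiscreteGeometry.bondGraph (1 / 100 : ℝ) y).neighborSet i).ncard < 12} : ℝ) ≤
      Literature.MathematicalPhysics.StatisticalMechanics.interactionEnergy
        (fun r => min 1 (max 0 (4 - 2 * r)) *
          Literature.MathematicalPhysics.StatisticalMechanics.lennardJones r) y := by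
  sorry

example : UnderCoordinationGap := stub_underCoordinationGap

/-- **STUB (R)** — the ring census gap at full coordination (tetrahedral-frustration pricing; XL: the
icosahedral / decahedral / Frank–Kasper column of the price list). -/
theorem stub_ringCensusGap :
    ∃ κ : ℝ, 0 < κ ∧ ∀ (N : ℕ) (y : Fin N → EuclideanSpace ℝ (Fin 3)), Function.Injective y →
      (N : ℝ) * (⨅ Q : Literature.MathematicalPhysics.StatisticalMechanics.PeriodicConfiguration 3,
          Q.energyPerParticle (fun r => min 1 (max 0 (4 - 2 * r)) *
            Literature.MathematicalPhysics.StatisticalMechanics.lennardJones r)) +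
        κ * (Nat.card {i : Fin N //
          ((Literature.Geometry.DiscreteGeometry.bondGraph (1 / 100 : ℝ) y).neighborSet i).ncard = 12 ∧
            ∃ j ∈ (Literature.Geometry.DiscreteGeometry.bondGraph (1 / 100 : ℝ) y).neighborSet i,
              Literature.Geometry.DiscreteGeometry.ringNumber (1 / 100 : ℝ) y i j ≠ 4} : ℝ) ≤
      Literature.MathematicalPhysics.StatisticalMechanics.interactionEnergy
        (fun r => min 1 (max 0 (4 - 2 * r)) *
          Literature.MathematicalPhysics.StatisticalMechanics.lennardJones r) y := by
  sorry

example : RingCensusGap := stub_ringCensusGap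

/-! ## §3 Name-keyed aliases (hypotheses of the composition)

`Registered.stub_X` is the statement of `stub_X` under the registered stub's short name, so that the
skeleton audit (`#h21_check_skeleton`: hypotheses admissible iff registered stubs BY NAME) accepts
`TruncatedCensusGap_of : Registered.stub_… → … → TruncatedCensusGap`. -/
namespace Registered

/-- Alias of `GappedKissingOnePercent` keyed by the registered stub name. -/
abbrev stub_gappedKissingOnePercent : Prop := GappedKissingOnePercent
/-- Alias of `UnderCoordinationGap` keyed by the registered stub name. -/
abbrev stub_underCoordinationGap : Prop := UnderCoordinationGap
/-- Alias of `RingCensusGap` keyed by the registered stub name. -/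
abbrev stub_ringCensusGap : Prop := RingCensusGap

end Registered

/-! ## §4 Proved glue (sorry-free) -/

/-- **The census covers the charge**: with no over-coordination, a charged site is under-coordinated
or twelve-coordinated with a ring defect. -/
theorem charged_cases (hO : NoOvercoordination) {N : ℕ} {y : Fin N → EuclideanSpace ℝ (Fin 3)}
    (hy : Function.Injective y) {i : Fin N} (hci : ¬ IsChargeFree (1 / 100 : ℝ) y i) :
    ((bondGraph (1 / 100 : ℝ) y).neighborSet i).ncard < 12 ∨
      (((bondGraph (1 / 100 : ℝ) y).neighborSet i).ncard = 12 ∧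
        ∃ j ∈ (bondGraph (1 / 100 : ℝ) y).neighborSet i, ringNumber (1 / 100 : ℝ) y i j ≠ 4) := by
  rcases lt_trichotomy (((bondGraph (1 / 100 : ℝ) y).neighborSet i).ncard) 12 with hlt | heq | hgt
  · exact Or.inl hlt
  · refine Or.inr ⟨heq, ?_⟩
    by_contra hall
    exact hci (isChargeFree_iff.2 ⟨heq, fun j hj => Classical.byContradiction fun hne => hall ⟨j, hj, hne⟩⟩)
  · exact absurd (hO N y hy i) (not_le.2 hgt)

/-- **`TruncatedCensusGap_of`** — the four registered stubs give the crux BY NAME: (O) := (O2) (O1);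
`#charged ≤ #U + #R` by the census cover, then the convex combination `½·(U-gap) + ½·(R-gap)` with
price `min κ_U κ_R / 2`. -/
theorem TruncatedCensusGap_of (h₀ : Registered.stub_gappedKissingOnePercent)
    (h₂ : Registered.stub_underCoordinationGap) (h₃ : Registered.stub_ringCensusGap) :
    TruncatedCensusGap := by
  have hO : NoOvercoordination := noOvercoordination_of h₀ stub_noOvercoordination_of_gappedKissing
  obtain ⟨κ₁, hκ₁, H₁⟩ := h₂
  obtain ⟨κ₂, hκ₂, H₂⟩ := h₃
  have hm0 : 0 ≤ min κ₁ κ₂ := le_min hκ₁.le hκ₂.le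
  refine ⟨min κ₁ κ₂ / 2, div_pos (lt_min hκ₁ hκ₂) two_pos, fun N y hy => ?_⟩
  have e1 := H₁ N y hy
  have e2 := H₂ N y hy
  -- the three finsets of the census
  set Ch := Finset.univ.filter fun i : Fin N => ¬ IsChargeFree (1 / 100 : ℝ) y i with hCh
  set Un := Finset.univ.filter fun i : Fin N =>
    ((bondGraph (1 / 100 : ℝ) y).neighborSet i).ncard < 12 with hUn
  set Rg := Finset.univ.filter fun i : Fin N =>
    ((bondGraph (1 / 100 : ℝ) y).neighborSet i).ncard = 12 ∧
      ∃ j ∈ (bondGraph (1 / 100 : ℝ) y).neighborSet i, ringNumber (1 / 100 : ℝ) y i j ≠ 4 with hRg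
  have hChNat : (Nat.card {i : Fin N // ¬ IsChargeFree (1 / 100 : ℝ) y i} : ℝ) = Ch.card := by
    rw [Nat.card_eq_fintype_card, Fintype.card_subtype]
  have hUnNat : (Nat.card {i : Fin N //
      ((bondGraph (1 / 100 : ℝ) y).neighborSet i).ncard < 12} : ℝ) = Un.card := by
    rw [Nat.card_eq_fintype_card, Fintype.card_subtype]
  have hRgNat : (Nat.card {i : Fin N //
      ((bondGraph (1 / 100 : ℝ) y).neighborSet i).ncard = 12 ∧
        ∃ j ∈ (bondGraph (1 / 100 : ℝ) y).neighborSet i, ringNumber (1 / 100 : ℝ) y i j ≠ 4} : ℝ) =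
      Rg.card := by
    rw [Nat.card_eq_fintype_card, Fintype.card_subtype]
  -- (1) the census covers the charge: `Ch ⊆ Un ∪ Rg`, hence `#Ch ≤ #Un + #Rg`
  have hcover : Ch ⊆ Un ∪ Rg := by
    intro i hi
    have hci : ¬ IsChargeFree (1 / 100 : ℝ) y i := (Finset.mem_filter.1 hi).2
    rcases charged_cases hO hy hci with hU | hR
    · exact Finset.mem_union_left _ (Finset.mem_filter.2 ⟨Finset.mem_univ _, hU⟩)
    · exact Finset.mem_union_right _ (Finset.mem_filter.2 ⟨Finset.mem_univ _, hR⟩)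
  have hcard : (Ch.card : ℝ) ≤ Un.card + Rg.card := by
    exact_mod_cast (Finset.card_le_card hcover).trans (Finset.card_union_le Un Rg)
  -- (2) the convex combination
  rw [hChNat]
  rw [hUnNat] at e1
  rw [hRgNat] at e2
  have hU0 : (0 : ℝ) ≤ Un.card := Nat.cast_nonneg _
  have hR0 : (0 : ℝ) ≤ Rg.card := Nat.cast_nonneg _
  have key : min κ₁ κ₂ / 2 * (Ch.card : ℝ) ≤ (κ₁ * Un.card + κ₂ * Rg.card) / 2 := by
    have a1 : min κ₁ κ₂ / 2 * (Ch.card : ℝ) ≤ min κ₁ κ₂ / 2 * (Un.card + Rg.card) :=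
      mul_le_mul_of_nonneg_left hcard (div_nonneg hm0 zero_le_two)
    have a2 : min κ₁ κ₂ * (Un.card : ℝ) ≤ κ₁ * Un.card :=
      mul_le_mul_of_nonneg_right (min_le_left _ _) hU0
    have a3 : min κ₁ κ₂ * (Rg.card : ℝ) ≤ κ₂ * Rg.card :=
      mul_le_mul_of_nonneg_right (min_le_right _ _) hR0
    linarith
  linarith

/-- Wiring check: the registered stubs feed `TruncatedCensusGap_of` as stated. -/
example : TruncatedCensusGap :=
  TruncatedCensusGap_of stub_gappedKissingOnePercent stub_underCoordinationGap stub_ringCensusGap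

/-! ## §5 Calibration (sorry-free): the split loses no strength -/

/-- The crux implies the under-coordination gap (`U ⊆ charged`: a charge-free site has `b = 12`). -/
theorem underCoordinationGap_of_truncatedCensusGap (h : TruncatedCensusGap) :
    UnderCoordinationGap := by
  obtain ⟨κ, hκ, h⟩ := h
  refine ⟨κ, hκ, fun N y hy => ?_⟩
  have h1 := h N y hy
  have hle : Nat.card {i : Fin N // ((bondGraph (1 / 100 : ℝ) y).neighborSet i).ncard < 12} ≤
      Nat.card {i : Fin N // ¬ IsChargeFree (1 / 100 : ℝ) y i} :=
    Nat.card_le_card_of_injective _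
      (Subtype.impEmbedding _ _ fun i
        (hi : ((bondGraph (1 / 100 : ℝ) y).neighborSet i).ncard < 12) hc =>
          absurd hc.ncard_neighborSet hi.ne).injective
  have hle' : κ * (Nat.card {i : Fin N //
      ((bondGraph (1 / 100 : ℝ) y).neighborSet i).ncard < 12} : ℝ) ≤
      κ * (Nat.card {i : Fin N // ¬ IsChargeFree (1 / 100 : ℝ) y i} : ℝ) :=
    mul_le_mul_of_nonneg_left (by exact_mod_cast hle) hκ.le
  exact le_trans (by linarith) h1

/-- The crux implies the ring census gap (`R ⊆ charged`: at a charge-free site every ring is `4`). -/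
theorem ringCensusGap_of_truncatedCensusGap (h : TruncatedCensusGap) : RingCensusGap := by
  obtain ⟨κ, hκ, h⟩ := h
  refine ⟨κ, hκ, fun N y hy => ?_⟩
  have h1 := h N y hy
  have hle : Nat.card {i : Fin N // ((bondGraph (1 / 100 : ℝ) y).neighborSet i).ncard = 12 ∧
        ∃ j ∈ (bondGraph (1 / 100 : ℝ) y).neighborSet i, ringNumber (1 / 100 : ℝ) y i j ≠ 4} ≤
      Nat.card {i : Fin N // ¬ IsChargeFree (1 / 100 : ℝ) y i} :=
    Nat.card_le_card_of_injective _
      (Subtype.impEmbedding _ _ fun i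
        (hi : ((bondGraph (1 / 100 : ℝ) y).neighborSet i).ncard = 12 ∧
          ∃ j ∈ (bondGraph (1 / 100 : ℝ) y).neighborSet i, ringNumber (1 / 100 : ℝ) y i j ≠ 4) hc => by
          obtain ⟨-, j, hj, hne⟩ := hi
          exact hne (hc.ringNumber_eq hj)).injective
  have hle' : κ * (Nat.card {i : Fin N // ((bondGraph (1 / 100 : ℝ) y).neighborSet i).ncard = 12 ∧
        ∃ j ∈ (bondGraph (1 / 100 : ℝ) y).neighborSet i, ringNumber (1 / 100 : ℝ) y i j ≠ 4} : ℝ) ≤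
      κ * (Nat.card {i : Fin N // ¬ IsChargeFree (1 / 100 : ℝ) y i} : ℝ) :=
    mul_le_mul_of_nonneg_left (by exact_mod_cast hle) hκ.le
  exact le_trans (by linarith) h1

/-- Hence, GIVEN (O1) (and the landed (O2)), the two pricing stubs are jointly EQUIVALENT to the
crux. -/
theorem truncatedCensusGap_iff_gaps (h₀ : GappedKissingOnePercent) :
    TruncatedCensusGap ↔ UnderCoordinationGap ∧ RingCensusGap :=
  ⟨fun h => ⟨underCoordinationGap_of_truncatedCensusGap h, ringCensusGap_of_truncatedCensusGap h⟩,
    fun h => TruncatedCensusGap_of h₀ h.1 h.2⟩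

end Summit.AtomisticToContinuum.Crystallization.Cruxes.TruncatedCensusGap.Birth

end
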